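import Summits.CriticalPhenomena.SAWScalingLimit.Theorems.SAWDefectDecoherenceBoundaryClosureRBoundaryDataTransferLattice
import Summits.CriticalPhenomena.SAWScalingLimit.Theorems.SAWDefectDecoherenceBoundaryClosureRGateMassLawsReduction
import HarnessLib

/-!
# Boundary data transfer, VI: column form of the arms, lines, and integer windows

Route `SAWDefectDecoherence`, crux `BoundaryClosureR` (stmt-CriticalPhenomena-14004), line
`pick-half-plane`, stub `stub_boundaryDataTransfer` (r11 stub 5c).  Small tools for the transfer of
the arm conditions (I1) and the divergence (I3):

* `east_cols_sum` / `west_cols_sum` — the landed `b`-frame increments (`frame_increments`) summed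
  between two arbitrary COLUMNS `a' ≤ a` east of the root (resp. `a ≤ a'` west of it):
  `(H(a) − H(a'))/F(b) = e^{iθ_arms}·(√3/6)·Σ_{a' ≤ k < a} Z_k/Z_b`; whence `east_cols_diff` /
  `west_cols_diff` (differences lie on the lines of direction `e^{iθ}`, `e^{i(θ−π/4)}`,
  `θ = π/8 − (3/8)W_b`) and `east_cols_norm`;
* `exists_two_lines` — two lines of directions `e^{iθ}`, `e^{i(θ−π/4)}` through `A`, `B` meet;
  `isClosed_line`, `exists_real_of_im_eq_zero` — the line `e^{iθ}ℝ` as a closed set;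
* `flat_of_window` / `mem_Icc_window` — the real window `|δ(k + μ/2) − re c| ≤ R'` as the integer
  interval `[⌈(re c − R')/δ − μ/2⌉, ⌊(re c + R')/δ − μ/2⌋]`;
* `floorSite_mem_upFace` / `floorSite_mem_belowFace` — the floor site `![k, m]` is a vertex of both
  faces of the floor dart `floorEdge k m` (the normaliser site `s_b`).
-/

noncomputable section

open scoped BigOperators
open Complex (I exp)
open Literature.Probability.LatticeModels Literature.Probability.RandomPlanarGeometry
open Literature.Probability.RandomPlanarGeometry.SAW
open Summit.CriticalPhenomena.SAWScalingLimit.Theorems.PickHalfPlane.BoundaryExactness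
open Summit.CriticalPhenomena.SAWScalingLimit.Theorems.PickHalfPlane.GateMass

namespace Summit.CriticalPhenomena.SAWScalingLimit.Theorems.PickHalfPlane.BoundaryDataTransfer

variable {Λ : Finset HexVertex}

/-! ### Column sums along the root's arms -/

/-- In `ℤ`, `Ico a (b+1) = insert b (Ico a b)` for `a ≤ b`. [folklore] -/
theorem Ico_add_one_eq_insert {a b : ℤ} (h : a ≤ b) : Finset.Ico a (b + 1) = insert b (Finset.Ico a b) := by
  rw [Finset.insert_Ico_right_eq_Ico_succ h]; rfl

/-- **East column sums**: for columns `ka < a' ≤ a ≤ k₂ + 1` east of the floor root,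
`(H(a, mr) − H(a', mr))/F(b) = e^{i(−(3/8)W_b − 7π/8)}·(√3/6)·Σ_{a' ≤ k < a} Z_k/Z_b`. [folklore] -/
theorem east_cols_sum (hΛ : hexDomainSimplyConnected Λ) {mr k₁ k₂ ka : ℤ}
    (hF : ∀ k : ℤ, k₁ ≤ k → k ≤ k₂ → ((![k, mr], 0) : HexVertex) ∈ Λ ∧
      ((![k, mr - 1], 1) : HexVertex) ∉ Λ ∧ (k < k₂ → ((![k, mr], 1) : HexVertex) ∈ Λ))
    (hka₁ : k₁ ≤ ka) (hka₂ : ka ≤ k₂) {kb m' : ℤ} (hUb : upFace kb m' ∈ Λ) (hBb : belowFace kb m' ∉ Λ)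
    (hneb : floorEdge kb m' ≠ floorEdge ka mr) (γb : HexMidEdgeSAW Λ (floorEdge ka mr) (floorEdge kb m'))
    {H : Site 2 → ℂ} (hH : IsPotential Λ (floorEdge ka mr) H) {a' : ℤ} (ha' : ka < a') :
    ∀ a : ℤ, a' ≤ a → a ≤ k₂ + 1 →
      (H ![a, mr] - H ![a', mr]) /
          hexParafermionicObservable Λ (floorEdge ka mr) hexCriticalFugacity (5 / 8) (floorEdge kb m') =
        exp (I * ((-(3 / 8 * γb.winding) - 7 / 8 * Real.pi : ℝ) : ℂ)) *
          ((Real.sqrt 3 / 6 * (∑ k ∈ Finset.Ico a' a,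
            ‖hexParafermionicObservable Λ (floorEdge ka mr) hexCriticalFugacity 0 (floorEdge k mr)‖) /
              ‖hexParafermionicObservable Λ (floorEdge ka mr) hexCriticalFugacity 0 (floorEdge kb m')‖ : ℝ) : ℂ) := by
  have hE := (frame_increments hΛ hF hka₁ hka₂ hUb hBb hneb γb hH).1
  intro a haa
  induction a, haa using Int.leInduction with
  | base => intro _; simp
  | succ a haa ih =>
    intro ha2
    rw [Ico_add_one_eq_insert haa, Finset.sum_insert Finset.right_notMem_Ico,
      show H ![a + 1, mr] - H ![a', mr] = (H ![a + 1, mr] - H ![a, mr]) + (H ![a, mr] - H ![a', mr]) by ring,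
      add_div, hE a (by omega) (by omega), ih (by omega)]
    push_cast
    ring

/-- **West column sums**: for columns `k₁ ≤ a ≤ a' ≤ ka` west of (or at) the root column,
`(H(a, mr) − H(a', mr))/F(b) = e^{i(−(3/8)W_b − 7π/8 − π/4)}·(√3/6)·Σ_{a ≤ k < a'} Z_k/Z_b`.
[folklore] -/
theorem west_cols_sum (hΛ : hexDomainSimplyConnected Λ) {mr k₁ k₂ ka : ℤ}
    (hF : ∀ k : ℤ, k₁ ≤ k → k ≤ k₂ → ((![k, mr], 0) : HexVertex) ∈ Λ ∧
      ((![k, mr - 1], 1) : HexVertex) ∉ Λ ∧ (k < k₂ → ((![k, mr], 1) : HexVertex) ∈ Λ))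
    (hka₁ : k₁ ≤ ka) (hka₂ : ka ≤ k₂) {kb m' : ℤ} (hUb : upFace kb m' ∈ Λ) (hBb : belowFace kb m' ∉ Λ)
    (hneb : floorEdge kb m' ≠ floorEdge ka mr) (γb : HexMidEdgeSAW Λ (floorEdge ka mr) (floorEdge kb m'))
    {H : Site 2 → ℂ} (hH : IsPotential Λ (floorEdge ka mr) H) {a : ℤ} (ha : k₁ ≤ a) :
    ∀ a' : ℤ, a ≤ a' → a' ≤ ka →
      (H ![a, mr] - H ![a', mr]) /
          hexParafermionicObservable Λ (floorEdge ka mr) hexCriticalFugacity (5 / 8) (floorEdge kb m') =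
        exp (I * ((-(3 / 8 * γb.winding) - 7 / 8 * Real.pi - Real.pi / 4 : ℝ) : ℂ)) *
          ((Real.sqrt 3 / 6 * (∑ k ∈ Finset.Ico a a',
            ‖hexParafermionicObservable Λ (floorEdge ka mr) hexCriticalFugacity 0 (floorEdge k mr)‖) /
              ‖hexParafermionicObservable Λ (floorEdge ka mr) hexCriticalFugacity 0 (floorEdge kb m')‖ : ℝ) : ℂ) := by
  have hW := (frame_increments hΛ hF hka₁ hka₂ hUb hBb hneb γb hH).2.1
  intro a' haa
  induction a', haa using Int.leInduction with
  | base => intro _; simp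
  | succ a' haa ih =>
    intro ha2
    rw [Ico_add_one_eq_insert haa, Finset.sum_insert Finset.right_notMem_Ico,
      show H ![a, mr] - H ![a' + 1, mr] = (H ![a', mr] - H ![a' + 1, mr]) + (H ![a, mr] - H ![a', mr]) by ring,
      add_div, hW a' (by omega) (by omega), ih (by omega)]
    push_cast
    ring

/-- **East column differences lie on the line of direction `e^{iθ}`**, `θ = π/8 − (3/8)W_b`, for any
two columns `a, a'` east of the root. [folklore] -/
theorem east_cols_diff (hΛ : hexDomainSimplyConnected Λ) {mr k₁ k₂ ka : ℤ}
    (hF : ∀ k : ℤ, k₁ ≤ k → k ≤ k₂ → ((![k, mr], 0) : HexVertex) ∈ Λ ∧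
      ((![k, mr - 1], 1) : HexVertex) ∉ Λ ∧ (k < k₂ → ((![k, mr], 1) : HexVertex) ∈ Λ))
    (hka₁ : k₁ ≤ ka) (hka₂ : ka ≤ k₂) {kb m' : ℤ} (hUb : upFace kb m' ∈ Λ) (hBb : belowFace kb m' ∉ Λ)
    (hneb : floorEdge kb m' ≠ floorEdge ka mr) (γb : HexMidEdgeSAW Λ (floorEdge ka mr) (floorEdge kb m'))
    {H : Site 2 → ℂ} (hH : IsPotential Λ (floorEdge ka mr) H) {a a' : ℤ} (ha : ka < a) (ha2 : a ≤ k₂ + 1)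
    (ha' : ka < a') (ha'2 : a' ≤ k₂ + 1) :
    ∃ s : ℝ, (H ![a, mr] - H ![a', mr]) /
        hexParafermionicObservable Λ (floorEdge ka mr) hexCriticalFugacity (5 / 8) (floorEdge kb m') =
      exp (((Real.pi / 8 - 3 / 8 * γb.winding : ℝ) : ℂ) * I) * s := by
  have h1 := east_cols_sum hΛ hF hka₁ hka₂ hUb hBb hneb γb hH (show ka < ka + 1 by omega) a (by omega) ha2
  have h2 := east_cols_sum hΛ hF hka₁ hka₂ hUb hBb hneb γb hH (show ka < ka + 1 by omega) a' (by omega) ha'2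
  have hsplit : H ![a, mr] - H ![a', mr] = (H ![a, mr] - H ![ka + 1, mr]) - (H ![a', mr] - H ![ka + 1, mr]) := by
    ring
  refine ⟨-(Real.sqrt 3 / 6 * (∑ k ∈ Finset.Ico (ka + 1) a,
      ‖hexParafermionicObservable Λ (floorEdge ka mr) hexCriticalFugacity 0 (floorEdge k mr)‖) /
        ‖hexParafermionicObservable Λ (floorEdge ka mr) hexCriticalFugacity 0 (floorEdge kb m')‖ -
      Real.sqrt 3 / 6 * (∑ k ∈ Finset.Ico (ka + 1) a',
      ‖hexParafermionicObservable Λ (floorEdge ka mr) hexCriticalFugacity 0 (floorEdge k mr)‖) /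
        ‖hexParafermionicObservable Λ (floorEdge ka mr) hexCriticalFugacity 0 (floorEdge kb m')‖), ?_⟩
  rw [hsplit, sub_div, h1, h2, exp_armPhase_eq]
  push_cast
  ring

/-- **West column differences lie on the line of direction `e^{i(θ − π/4)}`** for any two columns
`a, a'` in `[k₁, ka]`. [folklore] -/
theorem west_cols_diff (hΛ : hexDomainSimplyConnected Λ) {mr k₁ k₂ ka : ℤ}
    (hF : ∀ k : ℤ, k₁ ≤ k → k ≤ k₂ → ((![k, mr], 0) : HexVertex) ∈ Λ ∧
      ((![k, mr - 1], 1) : HexVertex) ∉ Λ ∧ (k < k₂ → ((![k, mr], 1) : HexVertex) ∈ Λ))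
    (hka₁ : k₁ ≤ ka) (hka₂ : ka ≤ k₂) {kb m' : ℤ} (hUb : upFace kb m' ∈ Λ) (hBb : belowFace kb m' ∉ Λ)
    (hneb : floorEdge kb m' ≠ floorEdge ka mr) (γb : HexMidEdgeSAW Λ (floorEdge ka mr) (floorEdge kb m'))
    {H : Site 2 → ℂ} (hH : IsPotential Λ (floorEdge ka mr) H) {a a' : ℤ} (ha : k₁ ≤ a) (ha2 : a ≤ ka)
    (ha' : k₁ ≤ a') (ha'2 : a' ≤ ka) :
    ∃ t : ℝ, (H ![a, mr] - H ![a', mr]) /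
        hexParafermionicObservable Λ (floorEdge ka mr) hexCriticalFugacity (5 / 8) (floorEdge kb m') =
      exp (((Real.pi / 8 - 3 / 8 * γb.winding - Real.pi / 4 : ℝ) : ℂ) * I) * t := by
  have h1 := west_cols_sum hΛ hF hka₁ hka₂ hUb hBb hneb γb hH ha ka ha2 le_rfl
  have h2 := west_cols_sum hΛ hF hka₁ hka₂ hUb hBb hneb γb hH ha' ka ha'2 le_rfl
  have hsplit : H ![a, mr] - H ![a', mr] = (H ![a, mr] - H ![ka, mr]) - (H ![a', mr] - H ![ka, mr]) := by
    ring
  have hphase : exp (I * ((-(3 / 8 * γb.winding) - 7 / 8 * Real.pi - Real.pi / 4 : ℝ) : ℂ)) =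
      -exp (((Real.pi / 8 - 3 / 8 * γb.winding - Real.pi / 4 : ℝ) : ℂ) * I) := by
    have e : I * ((-(3 / 8 * γb.winding) - 7 / 8 * Real.pi - Real.pi / 4 : ℝ) : ℂ) =
        ((Real.pi / 8 - 3 / 8 * γb.winding - Real.pi / 4 : ℝ) : ℂ) * I + -(Real.pi * I) := by
      push_cast; ring
    rw [e, Complex.exp_add, Complex.exp_neg, Complex.exp_pi_mul_I]
    ring
  refine ⟨-(Real.sqrt 3 / 6 * (∑ k ∈ Finset.Ico a ka,
      ‖hexParafermionicObservable Λ (floorEdge ka mr) hexCriticalFugacity 0 (floorEdge k mr)‖) /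
        ‖hexParafermionicObservable Λ (floorEdge ka mr) hexCriticalFugacity 0 (floorEdge kb m')‖ -
      Real.sqrt 3 / 6 * (∑ k ∈ Finset.Ico a' ka,
      ‖hexParafermionicObservable Λ (floorEdge ka mr) hexCriticalFugacity 0 (floorEdge k mr)‖) /
        ‖hexParafermionicObservable Λ (floorEdge ka mr) hexCriticalFugacity 0 (floorEdge kb m')‖), ?_⟩
  rw [hsplit, sub_div, h1, h2, hphase]
  push_cast
  ring

/-- **Norm of east column differences**: for `ka < a' ≤ a ≤ k₂ + 1`,
`‖(H(a) − H(a'))/F(b)‖ = (√3/6)·(Σ_{a' ≤ k < a} Z_k)/Z_b`. [folklore] -/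
theorem east_cols_norm (hΛ : hexDomainSimplyConnected Λ) {mr k₁ k₂ ka : ℤ}
    (hF : ∀ k : ℤ, k₁ ≤ k → k ≤ k₂ → ((![k, mr], 0) : HexVertex) ∈ Λ ∧
      ((![k, mr - 1], 1) : HexVertex) ∉ Λ ∧ (k < k₂ → ((![k, mr], 1) : HexVertex) ∈ Λ))
    (hka₁ : k₁ ≤ ka) (hka₂ : ka ≤ k₂) {kb m' : ℤ} (hUb : upFace kb m' ∈ Λ) (hBb : belowFace kb m' ∉ Λ)
    (hneb : floorEdge kb m' ≠ floorEdge ka mr) (γb : HexMidEdgeSAW Λ (floorEdge ka mr) (floorEdge kb m'))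
    {H : Site 2 → ℂ} (hH : IsPotential Λ (floorEdge ka mr) H) {a a' : ℤ} (ha' : ka < a') (haa : a' ≤ a)
    (ha2 : a ≤ k₂ + 1) :
    ‖(H ![a, mr] - H ![a', mr]) /
        hexParafermionicObservable Λ (floorEdge ka mr) hexCriticalFugacity (5 / 8) (floorEdge kb m')‖ =
      Real.sqrt 3 / 6 * (∑ k ∈ Finset.Ico a' a,
            ‖hexParafermionicObservable Λ (floorEdge ka mr) hexCriticalFugacity 0 (floorEdge k mr)‖) /
          ‖hexParafermionicObservable Λ (floorEdge ka mr) hexCriticalFugacity 0 (floorEdge kb m')‖ := by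
  rw [east_cols_sum hΛ hF hka₁ hka₂ hUb hBb hneb γb hH ha' a haa ha2, norm_mul,
    show I * ((-(3 / 8 * γb.winding) - 7 / 8 * Real.pi : ℝ) : ℂ) =
      ((-(3 / 8 * γb.winding) - 7 / 8 * Real.pi : ℝ) : ℂ) * I by ring,
    Complex.norm_exp_ofReal_mul_I, one_mul, Complex.norm_real, Real.norm_of_nonneg]
  have hZb := (normaliser_observable hΛ (hF ka hka₁ hka₂).1 (hF ka hka₁ hka₂).2.1 hUb hBb hneb γb).2
  exact div_nonneg (mul_nonneg (by positivity) (Finset.sum_nonneg fun i _ => norm_nonneg _)) hZb.le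

/-! ### Lines -/

/-- A vector whose rotation by `e^{−iθ}` is real lies on the line `e^{iθ}ℝ`. [folklore] -/
theorem exists_real_of_im_eq_zero {θ : ℝ} {v : ℂ} (h : (exp (-((θ : ℂ) * I)) * v).im = 0) :
    ∃ s : ℝ, v = exp ((θ : ℂ) * I) * s := by
  refine ⟨(exp (-((θ : ℂ) * I)) * v).re, ?_⟩
  have hv : v = exp ((θ : ℂ) * I) * (exp (-((θ : ℂ) * I)) * v) := by
    rw [← mul_assoc, ← Complex.exp_add, show (θ : ℂ) * I + -((θ : ℂ) * I) = 0 by ring, Complex.exp_zero,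
      one_mul]
  conv_lhs => rw [hv]
  congr 1
  exact Complex.ext (by simp) (by simp [h])

/-- Conversely, points of the line `e^{iθ}ℝ` have real rotation. [folklore] -/
theorem im_eq_zero_of_eq_exp_mul {θ : ℝ} {v : ℂ} {s : ℝ} (h : v = exp ((θ : ℂ) * I) * s) :
    (exp (-((θ : ℂ) * I)) * v).im = 0 := by
  rw [h, ← mul_assoc, ← Complex.exp_add, show -((θ : ℂ) * I) + (θ : ℂ) * I = 0 by ring, Complex.exp_zero,
    one_mul, Complex.ofReal_im]

/-- The line `e^{iθ}ℝ` is closed. [folklore] -/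
theorem isClosed_line (θ : ℝ) : IsClosed {v : ℂ | (exp (-((θ : ℂ) * I)) * v).im = 0} :=
  isClosed_eq (Complex.continuous_im.comp (continuous_const.mul continuous_id)) continuous_const

/-- **Two non-parallel lines meet**: for any `A, B` and `θ` there is `p` with `A ∈ p + e^{iθ}ℝ` and
`B ∈ p + e^{i(θ−π/4)}ℝ`. [folklore] -/
theorem exists_two_lines (A B : ℂ) (θ : ℝ) :
    ∃ p : ℂ, (∃ s : ℝ, A = p + exp ((θ : ℂ) * I) * s) ∧
      (∃ t : ℝ, B = p + exp (((θ - Real.pi / 4 : ℝ) : ℂ) * I) * t) := by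
  set q : ℝ := (exp (-((θ : ℂ) * I)) * (A - B)).im with hq
  set t₀ : ℝ := -(Real.sqrt 2 * q) with ht₀
  refine ⟨B + exp (((θ - Real.pi / 4 : ℝ) : ℂ) * I) * t₀, ?_, ⟨-t₀, by push_cast; ring⟩⟩
  -- `A − p` is on the line `e^{iθ}ℝ`
  have key : (exp (-((θ : ℂ) * I)) * (A - (B + exp (((θ - Real.pi / 4 : ℝ) : ℂ) * I) * t₀))).im = 0 := by
    have e0 : exp (-((θ : ℂ) * I)) * exp (((θ - Real.pi / 4 : ℝ) : ℂ) * I) =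
        exp (((-(Real.pi / 4) : ℝ) : ℂ) * I) := by
      rw [← Complex.exp_add]
      congr 1
      push_cast
      ring
    have e1 : exp (-((θ : ℂ) * I)) * (A - (B + exp (((θ - Real.pi / 4 : ℝ) : ℂ) * I) * t₀)) =
        exp (-((θ : ℂ) * I)) * (A - B) - (t₀ : ℂ) * exp (((-(Real.pi / 4) : ℝ) : ℂ) * I) := by
      rw [← e0]
      ring
    rw [e1, Complex.sub_im, Complex.im_ofReal_mul, Complex.exp_ofReal_mul_I_im, Real.sin_neg,
      Real.sin_pi_div_four, ← hq, ht₀]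
    have h2 : Real.sqrt 2 * Real.sqrt 2 = 2 := Real.mul_self_sqrt (by norm_num)
    have h3 : -(Real.sqrt 2 * q) * -(Real.sqrt 2 / 2) = Real.sqrt 2 * Real.sqrt 2 * q / 2 := by ring
    rw [h3, h2]
    ring
  obtain ⟨s, hs⟩ := exists_real_of_im_eq_zero key
  exact ⟨s, by rw [← hs]; ring⟩

/-! ### Integer windows -/

/-- **The real window as an integer interval**: if every column `k` with `|δ(k + μ/2) − re c| ≤ R'`
carries an exact flat floor cell, then the flat-floor clauses hold on
`[⌈(re c − R')/δ − μ/2⌉, ⌊(re c + R')/δ − μ/2⌋]` (in the three-clause form of the landed lattice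
lemmas). [folklore] -/
theorem flat_of_window {Λ : Finset HexVertex} {μ : ℤ} {δ R' : ℝ} {c : ℂ} (hδ : 0 < δ)
    (hW : ∀ k : ℤ, |δ * (k + μ / 2) - c.re| ≤ R' →
      upFace k μ ∈ Λ ∧ belowFace k μ ∉ Λ ∧ ((![k, μ], 1) : HexVertex) ∈ Λ ∧
        ((![k - 1, μ], 1) : HexVertex) ∈ Λ) :
    ∀ k : ℤ, ⌈(c.re - R') / δ - μ / 2⌉ ≤ k → k ≤ ⌊(c.re + R') / δ - μ / 2⌋ →
      ((![k, μ], 0) : HexVertex) ∈ Λ ∧ ((![k, μ - 1], 1) : HexVertex) ∉ Λ ∧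
        (k < ⌊(c.re + R') / δ - μ / 2⌋ → ((![k, μ], 1) : HexVertex) ∈ Λ) := by
  intro k hk1 hk2
  have h := hW k (abs_le_of_mem_Icc hδ (Finset.mem_Icc.2 ⟨hk1, hk2⟩))
  exact ⟨h.1, h.2.1, fun _ => h.2.2.1⟩

/-- A column strictly inside the real window lies in the integer interval. [folklore] -/
theorem mem_Icc_window {μ : ℤ} {δ R' : ℝ} {c : ℂ} (hδ : 0 < δ) {k : ℤ}
    (hk : |δ * (k + μ / 2) - c.re| < R') :
    ⌈(c.re - R') / δ - μ / 2⌉ ≤ k ∧ k ≤ ⌊(c.re + R') / δ - μ / 2⌋ :=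
  Finset.mem_Icc.1 (mem_Icc_of_abs_lt hδ hk)

/-! ### The normaliser site -/

/-- The floor site `![k, m]` is a vertex of the up-face `upFace k m`. [folklore] -/
theorem floorSite_mem_upFace (k m : ℤ) : (![k, m] : Site 2) ∈ hexFaceVertices (upFace k m) := by
  unfold upFace; rw [mem_hexFaceVertices_zero]; exact Or.inl rfl

/-- The floor site `![k, m]` is a vertex of the face `belowFace k m` below. [folklore] -/
theorem floorSite_mem_belowFace (k m : ℤ) : (![k, m] : Site 2) ∈ hexFaceVertices (belowFace k m) := by
  unfold belowFace; rw [mem_hexFaceVertices_one]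
  refine Or.inr (Or.inl ?_)
  ext i; fin_cases i <;> simp

/-- **Registered helper `boundaryDataTransfer_twoLines`** (crux stmt-CriticalPhenomena-14004, line
`pick-half-plane`, stub `stub_boundaryDataTransfer`, the point `p` of (I1)): two lines of directions
`e^{iθ}` and `e^{i(θ−π/4)}` meet (`exists_two_lines`). [folklore] -/
theorem boundaryDataTransfer_twoLines : ∀ (A B : ℂ) (θ : ℝ), ∃ p : ℂ, (∃ s : ℝ, A = p + Complex.exp ((θ : ℂ) * Complex.I) * s) ∧ (∃ t : ℝ, B = p + Complex.exp (((θ - Real.pi / 4 : ℝ) : ℂ) * Complex.I) * t) :=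
  fun A B θ => exists_two_lines A B θ

end Summit.CriticalPhenomena.SAWScalingLimit.Theorems.PickHalfPlane.BoundaryDataTransfer

end
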